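import Summits.HodgeConjecture.HodgeConjecture.Theorems.F0P3cStCharTSMuTrivial        -- ★ p849645 MU-TRIV `exists_level_forall_finTau_eq_of_mul`, `finTauArg_eq_of_glDiagonal_eq`
import Summits.HodgeConjecture.HodgeConjecture.Theorems.F0P3cStCharTSWeylRatioShell    -- ★ p849651 WEYL-LC `finWeylRatio_eq_finWeylRatio_of_hyperbolic_of_mul_units`
import Literature.NumberTheory.Rogawski1990.FinExplicitTransferFactorNondegenerate       -- ★ `isUnit_finGammaTwo`
import HarnessLib

/-!
# F0 · P3c · line LH6 «StCharTS» — road (D) «DEEP-FL», brick (c₅) «PER-COSET GLUE»: `τ_v · D_{G/H,v}` is constant along the level cosets `γ_H · (T ∩ K_{H,n})` of the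
# hyperbolic Levi shell

Cell `pub/hodgecm-mathlib`, crux H413 = `stmt-HodgeConjecture-24833` (lane `--supports … --as helper`), route HCCMUnconditional; seat LH6-p03 (g0) = road (D) owner of record
from 2026-09-02T05:54:27Z (desk F0P3b-plan (g23) ruling; previous owner LH6-p04 (g2), status v4 `F0/P3b/LH6-p04/g2/ROAD-D.status.v4.txt` 6a6e64fd5094df6c + the 05:51:45Z COSET
REFINEMENT ruling).  THEOREMS ONLY, sorry-free, ★-only imports; no definition ∕ instance ∕ notation ∕ named fact.  HONEST LABEL: HC_CM is proved only modulo the 7 printed citations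
(2 remaining: hLiu418 = stmt-HodgeConjecture-24832, h413 = stmt-HodgeConjecture-24833) until rung 0 closes; count-neutral plumbing of road (D): the per-coset constants
`c_j = Δ‴(u_j)·κ_G(b,n)∕κ_H(u_j,n′)` of the refined `H`-test function `Σ_j c_j 𝟙_{K_{H,n′} u_j K_{H,n′}}` are well defined because `Δ‴ = τ_v·D_{G/H,v}` (★ p849601 (c₃)) is
constant on each coset — this file.

THE MATHEMATICS ([Rogawski1990, §4.9 p. 55]: `Δ_{G/H} = τ_v · D_{G/H}` on the Levi, `τ_v(γ_H) = μ_v(u)·μ_v(−χ_g(u)∕det g)⁻¹`).  Let `γ_H⁰ = (diag(d′₀, d′₁), u)` lie on the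
HYPERBOLIC Levi shell `|d′₁|_{w′} < |u|_{w′} < |d′₀|_{w′}` and `γ_H = (diag(d′₀k₀, d′₁k₁), u·k_u)` with `k₀, k₁, k_u` in the level-`n` box `|k − 1|_{w′} < q_{w′}^{−(n+1)}`
(all `w′ ∣ v`).  (a) `D_{G/H,v}(γ_H) = D_{G/H,v}(γ_H⁰)` is ★ WEYL-LC (box elements have absolute value `1`).  (b) For `τ_v`: `u ↦ u·k_u`, and with `x := u∕d′₀`, `y := d′₁∕u`
(`|x|, |y| < 1`) one has `u·k_u − d′₀k₀ = −d′₀(1 − x)·c`, `u·k_u − d′₁k₁ = u(1 − y)·c′` where `c := (k₀ − x k_u)(1 − x)⁻¹`, `c′ := (k_u − y k₁)(1 − y)⁻¹` are again level-`n`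
box elements (ULTRAMETRIC: `(c − 1)(1 − x) = (k₀ − 1) − x(k_u − 1)` and `|1 − x| = 1`), so `−χ_g(u′)∕det g′ = (−χ_g(u)∕det g) · c c′ k₀⁻¹ k₁⁻¹` moves by a level-`n` box unit;
★ MU-TRIV (`μ_v = 1` on the level-`n` box for `n ≥ cond μ_v`) gives `τ_v(γ_H) = τ_v(γ_H⁰)`.  HEAD `exists_level_forall_finTau_eq_and_finWeylRatio_eq`.

## References
* [Rogawski1990] J. D. Rogawski, *Automorphic Representations of Unitary Groups in Three Variables*, Ann. of Math. Stud. 123 (1990): §4.9 p. 55; Prop. 8.1.3 (proof) p. 116;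
  §12.7 L. 12.7.3 p. 195.
* [NeukirchANT1999] J. Neukirch, *Algebraic Number Theory*, Springer GMW 322 (1999): Ch. II §6 (the strong triangle inequality; principal units `U^{(n)}`).
-/

set_option autoImplicit false
-- the mandated namespace has the single-problem summit's repeated segment (`HodgeConjecture.HodgeConjecture`)
set_option linter.dupNamespace false

noncomputable section

open Matrix NumberField IsDedekindDomain
open scoped MatrixGroups
open Literature.NumberTheory Literature.NumberTheory.GaloisRepresentations Literature.NumberTheory.Rogawski1990 Literature.NumberTheory.Automorphic Literature.NumberTheory.Automorphic.UnitaryGroup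

namespace Summit.HodgeConjecture.HodgeConjecture.Cruxes.H413.F0P3cStCharTSDeltaCosetConst

/-! ## §1 Principal-unit (box) algebra for a valuation -/

section Box

variable {K Γ₀ : Type*} [Field K] [LinearOrderedCommGroupWithZero Γ₀] (val : Valuation K Γ₀)

/-- `|a − 1| < 1 ⟹ |a| = 1`. [cite: NeukirchANT1999, Ch. II §6] -/
theorem map_eq_one_of_map_sub_one_lt_one {a : K} (h : val (a - 1) < 1) : val a = 1 := by
  rw [show a = 1 + (a - 1) by ring]
  exact Valuation.map_one_add_of_lt val h

/-- The box `|· − 1| < r` (`r ≤ 1`) is closed under products. [cite: NeukirchANT1999, Ch. II §6] -/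
theorem map_mul_sub_one_lt {a b : K} {r : Γ₀} (hr : r ≤ 1) (ha : val (a - 1) < r) (hb : val (b - 1) < r) : val (a * b - 1) < r := by
  rw [show a * b - 1 = a * (b - 1) + (a - 1) by ring]
  refine Valuation.map_add_lt val ?_ ha
  rw [Valuation.map_mul, map_eq_one_of_map_sub_one_lt_one val (ha.trans_le hr), one_mul]
  exact hb

/-- The box `|· − 1| < r` (`r ≤ 1`) is closed under inverses: `a·b = 1`, `|a − 1| < r ⟹ |b − 1| < r`. [cite: NeukirchANT1999, Ch. II §6] -/
theorem map_sub_one_lt_of_mul_eq_one {a b : K} {r : Γ₀} (hr : r ≤ 1) (hab : a * b = 1) (ha : val (a - 1) < r) : val (b - 1) < r := by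
  have ha1 : val a = 1 := map_eq_one_of_map_sub_one_lt_one val (ha.trans_le hr)
  have hb1 : val b = 1 := by
    have h := congrArg val hab
    rwa [Valuation.map_mul, ha1, one_mul, Valuation.map_one] at h
  rw [show b - 1 = b * (1 - a) by linear_combination hab, Valuation.map_mul, hb1, one_mul, Valuation.map_sub_swap]
  exact ha

/-- **The ultrametric coset step**: `|x| < 1`, `k, k′` in the box `|· − 1| < r ≤ 1`, and `c·(1 − x) = k − x·k′ ⟹ |c − 1| < r` (indeed `(c − 1)(1 − x) = (k − 1) − x(k′ − 1)`
and `|1 − x| = 1`). [cite: NeukirchANT1999, Ch. II §6] -/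
theorem map_sub_one_lt_of_mul_one_sub_eq {x k k' c : K} {r : Γ₀} (hx : val x < 1) (hk : val (k - 1) < r) (hk' : val (k' - 1) < r)
    (hc : c * (1 - x) = k - x * k') : val (c - 1) < r := by
  have h1x : val (1 - x) = 1 := Valuation.map_one_sub_of_lt val hx
  have h : val ((c - 1) * (1 - x)) < r := by
    rw [show (c - 1) * (1 - x) = (k - 1) + -(x * (k' - 1)) by linear_combination hc]
    refine Valuation.map_add_lt val hk ?_
    rw [Valuation.map_neg, Valuation.map_mul]
    calc val x * val (k' - 1) ≤ 1 * val (k' - 1) := mul_le_mul' hx.le le_rfl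
      _ < r := by rw [one_mul]; exact hk'
  rwa [Valuation.map_mul, h1x, mul_one] at h

/-- `|x|·|d| = |u|` and `|u| < |d| ⟹ |x| < 1` (the quotient `x = u∕d` on the hyperbolic shell). [cite: NeukirchANT1999, Ch. II §6] -/
theorem map_lt_one_of_mul_eq {x d u : K} (hxd : x * d = u) (hlt : val u < val d) : val x < 1 :=
  lt_of_not_ge fun h => hlt.not_ge (by rw [← hxd, Valuation.map_mul]; exact le_mul_of_one_le_left' h)

end Box

/-! ## §2 Box elements of the semilocal ring `Π_{w′∣v} L_{w′}` -/

variable (L : Type) [Field L] [NumberField L] [IsCMField L] (v : HeightOneSpectrum (𝓞 ↥(maximalRealSubfield L)))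

omit [IsCMField L] in
/-- `q^{−(n+1)} ≤ 1` in the value group. [cite: NeukirchANT1999, Ch. II §6] -/
theorem exp_neg_succ_le_one (n : ℕ) : WithZero.exp (-((n + 1 : ℕ) : ℤ)) ≤ (1 : WithZero (Multiplicative ℤ)) := by
  rw [← WithZero.exp_zero]
  exact WithZero.exp_le_exp.2 (by omega)

omit [IsCMField L] in
/-- A box element has absolute value `1` at every `w′ ∣ v`. [cite: NeukirchANT1999, Ch. II §6] -/
theorem norm_apply_eq_one_of_box {x : LocalRing L v} {n : ℕ} (hx : ∀ w' : PlacesOver L v, Valued.v (x w' - 1) < WithZero.exp (-((n + 1 : ℕ) : ℤ)))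
    (w' : PlacesOver L v) : ‖x w'‖ = 1 := by
  have h1 : Valued.v (x w') = 1 := map_eq_one_of_map_sub_one_lt_one _ ((hx w').trans_le (exp_neg_succ_le_one n))
  exact le_antisymm (Valued.toNormedField.norm_le_one_iff.2 h1.le) (Valued.toNormedField.one_le_norm_iff.2 h1.ge)

omit [IsCMField L] in
/-- An element of `Π_{w′} L_{w′}` all of whose components are non-zero is a unit. [cite: NeukirchANT1999, Ch. II §6] -/
theorem isUnit_of_forall_apply_ne_zero {x : LocalRing L v} (hx : ∀ w' : PlacesOver L v, x w' ≠ 0) : IsUnit x :=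
  Pi.isUnit_iff.2 fun w' => isUnit_iff_ne_zero.2 (hx w')

/-! ## §3 HEAD — `τ_v` and `D_{G/H,v}` are constant along level cosets of the hyperbolic Levi shell -/

/-- **(c₅) PER-COSET GLUE.**  There is a level `n` (`n ≥ cond μ_v`, ★ MU-TRIV) such that for `γ_H⁰ = (diag(d′₀, d′₁), u)` on the hyperbolic Levi shell
(`|u|_{w′} < |d′₀|_{w′}`, `|d′₁|_{w′} < |u|_{w′}` for all `w′ ∣ v`) and `γ_H = (diag(d′₀k₀, d′₁k₁), u·k_u)` with `k₀, k₁, k_u` in the level-`n` box, BOTH factors of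
`Δ‴ = τ_v · D_{G/H,v}` agree at `γ_H` and `γ_H⁰`: `finTau γ_H = finTau γ_H⁰` and `finWeylRatio γ_H = finWeylRatio γ_H⁰`.
[cite: Rogawski1990, §4.9 p. 55; Prop. 8.1.3 proof p. 116] [cite: NeukirchANT1999, Ch. II §6] -/
theorem exists_level_forall_finTau_eq_and_finWeylRatio_eq (μ : HeckeCharacter L) :
    ∃ n : ℕ, ∀ (γH γH₀ : (cmDatum L 2 (Matrix.of fun i j : Fin 2 => if i.val + j.val + 1 = 2 then (1 : L) else 0)).Local v ×
    (cmDatum L 1 (Matrix.of fun i j : Fin 1 => if i.val + j.val + 1 = 1 then (1 : L) else 0)).Local v)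
      (d' e' : Fin 2 → (LocalRing L v)ˣ) (k : Fin 2 → LocalRing L v) (ku : LocalRing L v),
      glDiagonal 2 (LocalRing L v) d' = (γH₀.1.val : GL (Fin 2) (LocalRing L v)) →
      glDiagonal 2 (LocalRing L v) e' = (γH.1.val : GL (Fin 2) (LocalRing L v)) →
      (∀ i, ∀ w' : PlacesOver L v, Valued.v (k i w' - 1) < WithZero.exp (-((n + 1 : ℕ) : ℤ))) →
      (∀ w' : PlacesOver L v, Valued.v (ku w' - 1) < WithZero.exp (-((n + 1 : ℕ) : ℤ))) →
      (∀ i, (e' i : LocalRing L v) = d' i * k i) → finGammaTwo L v γH = finGammaTwo L v γH₀ * ku →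
      (∀ w' : PlacesOver L v, Valued.v (finGammaTwo L v γH₀ w') < Valued.v ((d' 0 : LocalRing L v) w')) →
      (∀ w' : PlacesOver L v, Valued.v ((d' 1 : LocalRing L v) w') < Valued.v (finGammaTwo L v γH₀ w')) →
      finTau L v γH μ = finTau L v γH₀ μ ∧ finWeylRatio L v γH = finWeylRatio L v γH₀ := by
  obtain ⟨n, hn⟩ := F0P3cStCharTSMuTrivial.exists_level_forall_finTau_eq_of_mul L v μ
  refine ⟨n, fun γH γH₀ d' e' k ku hd' he' hk hku he hu hv₀ hv₁ => ⟨?_, ?_⟩⟩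
  · -- names
    have hr := exp_neg_succ_le_one n
    set u := finGammaTwo L v γH₀ with hudef
    have huu : IsUnit u := isUnit_finGammaTwo L v γH₀
    set d₀ : LocalRing L v := (d' 0 : LocalRing L v) with hd₀def
    set d₁ : LocalRing L v := (d' 1 : LocalRing L v) with hd₁def
    set d₀i : LocalRing L v := (((d' 0)⁻¹ : (LocalRing L v)ˣ) : LocalRing L v) with hd₀idef
    set d₁i : LocalRing L v := (((d' 1)⁻¹ : (LocalRing L v)ˣ) : LocalRing L v) with hd₁idef
    set ui : LocalRing L v := ((huu.unit⁻¹ : (LocalRing L v)ˣ) : LocalRing L v) with huidef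
    have hd₀i : d₀i * d₀ = 1 := by rw [hd₀idef, hd₀def, Units.inv_mul]
    have hd₁i : d₁i * d₁ = 1 := by rw [hd₁idef, hd₁def, Units.inv_mul]
    have hui : u * ui = 1 := by rw [huidef]; exact huu.mul_val_inv
    set x : LocalRing L v := u * d₀i with hxdef
    set y : LocalRing L v := d₁ * ui with hydef
    have hxd : x * d₀ = u := by rw [hxdef, mul_assoc, hd₀i, mul_one]
    have hyu : y * u = d₁ := by rw [hydef, mul_assoc, mul_comm ui, hui, mul_one]
    -- `|x|, |y| < 1` componentwise, hence `1 - x`, `1 - y` are units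
    have hx : ∀ w' : PlacesOver L v, Valued.v (x w') < 1 := fun w' =>
      map_lt_one_of_mul_eq _ (by rw [← Pi.mul_apply, hxd]) (hv₀ w')
    have hy : ∀ w' : PlacesOver L v, Valued.v (y w') < 1 := fun w' =>
      map_lt_one_of_mul_eq _ (by rw [← Pi.mul_apply, hyu]) (hv₁ w')
    have h1x : IsUnit (1 - x) := isUnit_of_forall_apply_ne_zero L v fun w' h0 => by
      have h := Valuation.map_one_sub_of_lt Valued.v (hx w')
      rw [show (1 : (w'.1).adicCompletion L) - x w' = (1 - x) w' from rfl, h0, Valuation.map_zero] at h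
      exact zero_ne_one h
    have h1y : IsUnit (1 - y) := isUnit_of_forall_apply_ne_zero L v fun w' h0 => by
      have h := Valuation.map_one_sub_of_lt Valued.v (hy w')
      rw [show (1 : (w'.1).adicCompletion L) - y w' = (1 - y) w' from rfl, h0, Valuation.map_zero] at h
      exact zero_ne_one h
    set xi : LocalRing L v := ((h1x.unit⁻¹ : (LocalRing L v)ˣ) : LocalRing L v) with hxidef
    set yi : LocalRing L v := ((h1y.unit⁻¹ : (LocalRing L v)ˣ) : LocalRing L v) with hyidef
    have hxi : (1 - x) * xi = 1 := by rw [hxidef]; exact h1x.mul_val_inv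
    have hyi : (1 - y) * yi = 1 := by rw [hyidef]; exact h1y.mul_val_inv
    -- the coset corrections `c`, `c'` and the inverses `z₀ = k₀⁻¹`, `z₁ = k₁⁻¹`
    set c : LocalRing L v := (k 0 - x * ku) * xi with hcdef
    set c' : LocalRing L v := (ku - y * k 1) * yi with hc'def
    have hc : c * (1 - x) = k 0 - x * ku := by rw [hcdef, mul_assoc, mul_comm xi, hxi, mul_one]
    have hc' : c' * (1 - y) = ku - y * k 1 := by rw [hc'def, mul_assoc, mul_comm yi, hyi, mul_one]
    set e₀i : LocalRing L v := (((e' 0)⁻¹ : (LocalRing L v)ˣ) : LocalRing L v) with he₀idef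
    set e₁i : LocalRing L v := (((e' 1)⁻¹ : (LocalRing L v)ˣ) : LocalRing L v) with he₁idef
    have he₀i : e₀i * (d₀ * k 0) = 1 := by rw [he₀idef, hd₀def, ← he 0, Units.inv_mul]
    have he₁i : e₁i * (d₁ * k 1) = 1 := by rw [he₁idef, hd₁def, ← he 1, Units.inv_mul]
    set z₀ : LocalRing L v := d₀ * e₀i with hz₀def
    set z₁ : LocalRing L v := d₁ * e₁i with hz₁def
    have hz₀ : k 0 * z₀ = 1 := by rw [hz₀def]; linear_combination he₀i
    have hz₁ : k 1 * z₁ = 1 := by rw [hz₁def]; linear_combination he₁i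
    -- the box property of `y₂ := c · c' · z₀ · z₁`
    have hbox : ∀ w' : PlacesOver L v, Valued.v ((c * c' * z₀ * z₁) w' - 1) < WithZero.exp (-((n + 1 : ℕ) : ℤ)) := by
      intro w'
      have hcw : Valued.v (c w' - 1) < WithZero.exp (-((n + 1 : ℕ) : ℤ)) :=
        map_sub_one_lt_of_mul_one_sub_eq _ (hx w') (hk 0 w') (hku w')
          (by have h := congrArg (fun f : LocalRing L v => f w') hc; simpa only [Pi.mul_apply, Pi.sub_apply, Pi.one_apply] using h)
      have hc'w : Valued.v (c' w' - 1) < WithZero.exp (-((n + 1 : ℕ) : ℤ)) :=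
        map_sub_one_lt_of_mul_one_sub_eq _ (hy w') (hku w') (hk 1 w')
          (by have h := congrArg (fun f : LocalRing L v => f w') hc'; simpa only [Pi.mul_apply, Pi.sub_apply, Pi.one_apply] using h)
      have hz₀w : Valued.v (z₀ w' - 1) < WithZero.exp (-((n + 1 : ℕ) : ℤ)) :=
        map_sub_one_lt_of_mul_eq_one _ hr (by have h := congrArg (fun f : LocalRing L v => f w') hz₀; simpa only [Pi.mul_apply, Pi.one_apply] using h) (hk 0 w')
      have hz₁w : Valued.v (z₁ w' - 1) < WithZero.exp (-((n + 1 : ℕ) : ℤ)) :=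
        map_sub_one_lt_of_mul_eq_one _ hr (by have h := congrArg (fun f : LocalRing L v => f w') hz₁; simpa only [Pi.mul_apply, Pi.one_apply] using h) (hk 1 w')
      simp only [Pi.mul_apply]
      exact map_mul_sub_one_lt _ hr (map_mul_sub_one_lt _ hr (map_mul_sub_one_lt _ hr hcw hc'w) hz₀w) hz₁w
    -- the second argument of `τ_v` moves by `y₂`
    have hA₀ := F0P3cStCharTSMuTrivial.finTauArg_eq_of_glDiagonal_eq L v hd'
    have hA := F0P3cStCharTSMuTrivial.finTauArg_eq_of_glDiagonal_eq L v he'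
    rw [hu] at hA
    rw [← hudef] at hA₀
    have hf₀ : u * ku - (e' 0 : LocalRing L v) = -(d₀ * ((1 - x) * c)) := by
      rw [he 0, ← hd₀def]; linear_combination d₀ * hc - ku * hxd
    have hf₁ : u * ku - (e' 1 : LocalRing L v) = u * ((1 - y) * c') := by
      rw [he 1, ← hd₁def]; linear_combination (-u) * hc' + k 1 * hyu
    have hg₀ : u - d₀ = -(d₀ * (1 - x)) := by linear_combination (-1 : LocalRing L v) * hxd
    have hg₁ : u - d₁ = u * (1 - y) := by linear_combination hyu
    have harg : finTauArg L v γH = finTauArg L v γH₀ * (c * c' * z₀ * z₁) := by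
      rw [hA, hA₀, hf₀, hf₁, ← hd₀def, ← hd₁def, hg₀, hg₁, ← he₀idef, ← he₁idef, ← hd₀idef, ← hd₁idef, hz₀def, hz₁def]
      calc -(-(d₀ * ((1 - x) * c)) * (u * ((1 - y) * c'))) * (e₀i * e₁i)
          = -(-(d₀ * (1 - x)) * (u * (1 - y))) * (d₀i * d₁i) * (c * c' * (d₀ * e₀i) * (d₁ * e₁i)) * 1 * 1 -
              -(-(d₀ * ((1 - x) * c)) * (u * ((1 - y) * c'))) * (e₀i * e₁i) * ((d₀i * d₀) * (d₁i * d₁) - 1) := by ring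
        _ = -(-(d₀ * (1 - x)) * (u * (1 - y))) * (d₀i * d₁i) * (c * c' * (d₀ * e₀i) * (d₁ * e₁i)) := by
          rw [hd₀i, hd₁i, mul_one, mul_one, mul_one, sub_self, mul_zero, sub_zero]
    exact hn γH γH₀ ku (c * c' * z₀ * z₁) hku hbox hu harg
  · -- `D_{G/H,v}`: ★ WEYL-LC with absolute values read off the valuations
    exact F0P3cStCharTSWeylRatioShell.finWeylRatio_eq_finWeylRatio_of_hyperbolic_of_mul_units L v γH₀ γH hd' he'
      (fun w' => Valued.toNormedField.norm_lt_iff.2 (hv₀ w')) (fun w' => Valued.toNormedField.norm_lt_iff.2 (hv₁ w')) k ku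
      (fun i w' => norm_apply_eq_one_of_box L v (hk i) w') (fun w' => norm_apply_eq_one_of_box L v hku w') (he 0) (he 1) hu

/-- **(c₅) PER-COSET GLUE, product form**: under the hypotheses of ★ `exists_level_forall_finTau_eq_and_finWeylRatio_eq`, `τ_v(γ_H)·D(γ_H) = τ_v(γ_H⁰)·D(γ_H⁰)` — the value of
★ p849601 (c₃) `Δ‴(γ_H, out c₀) = finTau · finWeylRatio` is constant along the level-`n` coset of `γ_H⁰` in the hyperbolic Levi shell. [cite: Rogawski1990, §4.9 p. 55] -/
theorem exists_level_forall_finTau_mul_finWeylRatio_eq (μ : HeckeCharacter L) :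
    ∃ n : ℕ, ∀ (γH γH₀ : (cmDatum L 2 (Matrix.of fun i j : Fin 2 => if i.val + j.val + 1 = 2 then (1 : L) else 0)).Local v ×
    (cmDatum L 1 (Matrix.of fun i j : Fin 1 => if i.val + j.val + 1 = 1 then (1 : L) else 0)).Local v)
      (d' e' : Fin 2 → (LocalRing L v)ˣ) (k : Fin 2 → LocalRing L v) (ku : LocalRing L v),
      glDiagonal 2 (LocalRing L v) d' = (γH₀.1.val : GL (Fin 2) (LocalRing L v)) →
      glDiagonal 2 (LocalRing L v) e' = (γH.1.val : GL (Fin 2) (LocalRing L v)) →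
      (∀ i, ∀ w' : PlacesOver L v, Valued.v (k i w' - 1) < WithZero.exp (-((n + 1 : ℕ) : ℤ))) →
      (∀ w' : PlacesOver L v, Valued.v (ku w' - 1) < WithZero.exp (-((n + 1 : ℕ) : ℤ))) →
      (∀ i, (e' i : LocalRing L v) = d' i * k i) → finGammaTwo L v γH = finGammaTwo L v γH₀ * ku →
      (∀ w' : PlacesOver L v, Valued.v (finGammaTwo L v γH₀ w') < Valued.v ((d' 0 : LocalRing L v) w')) →
      (∀ w' : PlacesOver L v, Valued.v ((d' 1 : LocalRing L v) w') < Valued.v (finGammaTwo L v γH₀ w')) →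
      finTau L v γH μ * (finWeylRatio L v γH : ℂ) = finTau L v γH₀ μ * (finWeylRatio L v γH₀ : ℂ) := by
  obtain ⟨n, hn⟩ := exists_level_forall_finTau_eq_and_finWeylRatio_eq L v μ
  refine ⟨n, fun γH γH₀ d' e' k ku hd' he' hk hku he hu hv₀ hv₁ => ?_⟩
  obtain ⟨h₁, h₂⟩ := hn γH γH₀ d' e' k ku hd' he' hk hku he hu hv₀ hv₁
  rw [h₁, h₂]

end Summit.HodgeConjecture.HodgeConjecture.Cruxes.H413.F0P3cStCharTSDeltaCosetConst

end
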